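import Literature.NumberTheory.EllipticCurves.Kato2004.IwasawaH1CoeffBoundedInvariantsProofs
import HarnessLib

/-!
# Kato 2004 (Astérisque 295) Thm. 12.4 (2) for `𝒪_λ`-lattices: `𝐇¹_Γ(T_ρ)` is a torsion-free
# `Λ_𝒪`-module whenever `ρ ⊗ ℚ̄_p` is IRREDUCIBLE with NON-ABELIAN image — the representation-
# theoretic form of the last input (proofs only)

Topic `NumberTheory/EllipticCurves`, sub-directory `Kato2004` (namespace = path).  THEOREMS ONLY.  Seat
`bsd-wall-tp2-p2x-w2` g23, closing file of the series on the print leaf K0b (`Kato2004.thm12_4_newform`,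
clause "`𝐇¹(T)` is a torsion free `Λ`-module"; item stmt-BirchSwinnertonDyer-24115, route
`ResidualThetaTransportAtTwo`).  `IwasawaH1CoeffBoundedInvariantsProofs` reduced the clause to «`T_ρ` has
no non-zero `Gal(ℚ̄/ℚ_∞)`-fixed vector»; here that statement is derived from the shape in which the
literature supplies it for newforms (Ribet: `V_{g,λ}` is absolutely irreducible, in particular has
non-abelian image):

* `forall_fixed_eq_zero_of_isIrreducible` — LINEAR ALGEBRA: for `𝒪 = padicCoeffIntegers S`,
  `ρ : Γ_ℚ → GL_n(𝒪)`, and a normal subgroup `G ⊴ Γ_ℚ` containing all commutators (e.g. the kernel of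
  a `ℤ_p`-extension): if the base change of `ρ` to `ℚ̄_p` is irreducible (Mathlib
  `Representation.IsIrreducible` of `FramedRep.baseChangeRepresentation`) and the image of `ρ` is not
  commutative, then `𝒪ⁿ` has no non-zero `G`-fixed vector.  Proof: the `ℚ̄_p`-span `V` of the
  `G`-fixed vectors is `Γ_ℚ`-stable (normality), hence `0` — done — or everything; in the latter case
  `G` acts trivially on `ℚ̄_pⁿ`, so `ρ(g) = 1` for `g ∈ G ⊇ [Γ_ℚ, Γ_ℚ]` and the image is abelian.
* **`IwasawaH1DataCoeff.isTorsionFree_of_isIrreducible`** — consequently, for `ℚ_p(S)/ℚ_p` finite,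
  every pin `I` of `𝐇¹_Γ(T_ρ)` along a `ℤ_p`-extension `κ` with topological generator `γ`:
  `ρ ⊗ ℚ̄_p` irreducible with non-abelian image ⟹ `Module.IsTorsionFree Λ_𝒪 I.H`;
  `isTorsionFree_newform_of_isIrreducible` — on the binders of `thm12_4_newform`.

HONEST FRAMING: the remaining input for clause (b) of K0b is now exactly «the integral model `ρ` of
`V_{F_λ}(g)(1)` is irreducible over `ℚ̄_p` with non-abelian image» — Ribet's theorem for weight-`2`
newforms (Ribet 1977 / 1985; Kato (14.10.5)), a Literature fact to be typed; it is NOT derivable from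
the `HasFrobCharpolyAt` binders without Chebotarev/Brauer–Nesbitt.  (12.2.1) and the rank clause of
K0b are untouched; BSD is not advanced by this file.

## References

* [Kato2004Asterisque] K. Kato, Astérisque 295 (2004): Thm. 12.4 (2) (p. 221), (14.10.5) (p. 241).
* [Ribet1977Nebentypus] K. Ribet, *Galois representations attached to eigenforms with Nebentypus*, LNM 601
  (1977), Thm. 2.3 (irreducibility of `ρ_{f,λ}`).
-/

noncomputable section

open scoped NumberField
open Field CategoryTheory Topology Polynomial Matrix
open Literature.NumberTheory.GaloisRepresentations
open Literature.NumberTheory.EllipticCurves Literature.NumberTheory.EllipticCurves.Kato2004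
open Literature.NumberTheory.EllipticCurves.Kato2004.EulerSystemValues

namespace Literature.NumberTheory.EllipticCurves.Kato2004

namespace IwasawaH1CoeffTorsionFree

variable {p : ℕ} [Fact p.Prime] (S : Set (PadicAlgCl p)) {n : ℕ}

/-- **Irreducible over `ℚ̄_p` with non-abelian image ⟹ no non-zero fixed vector under a normal
co-abelian subgroup.**  For `𝒪 = padicCoeffIntegers S`, `ρ : Γ_ℚ → GL_n(𝒪)`, `G ⊴ Γ_ℚ` containing every
commutator `στσ⁻¹τ⁻¹`: if `FramedRep.baseChangeRepresentation 𝒪.subtype ρ` (the action on `ℚ̄_pⁿ`) is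
irreducible and `ρ σ ρ τ ≠ ρ τ ρ σ` for some `σ, τ`, then every `G`-fixed `m ∈ 𝒪ⁿ` is `0` (the
`ℚ̄_p`-span of the fixed vectors is a subrepresentation; if it is everything, `G ⊇ [Γ_ℚ,Γ_ℚ]` acts
trivially and the image is abelian). [cite: Ribet1977Nebentypus, Thm. 2.3] [cite: Kato2004Asterisque, (14.10.5) (p. 241)] -/
theorem forall_fixed_eq_zero_of_isIrreducible (ρ : FramedGaloisRep ℚ (padicCoeffIntegers S) n)
    (G : Subgroup (absoluteGaloisGroup ℚ)) [G.Normal]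
    (hG : ∀ σ τ : absoluteGaloisGroup ℚ, σ * τ * σ⁻¹ * τ⁻¹ ∈ G)
    (hirr : (FramedRep.baseChangeRepresentation (padicCoeffIntegers S).subtype ρ).IsIrreducible)
    (hnonab : ∃ σ τ : absoluteGaloisGroup ℚ, ρ σ * ρ τ ≠ ρ τ * ρ σ)
    (m : Fin n → padicCoeffIntegers S) (hm : ∀ g ∈ G, ρ.toGaloisRep g m = m) : m = 0 := by
  let φ : padicCoeffIntegers S →+* PadicAlgCl p := (padicCoeffIntegers S).subtype
  let ρK := FramedRep.baseChangeRepresentation φ ρ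
  -- the inclusion `𝒪ⁿ → Kⁿ` and its compatibility with the actions
  let ι : (Fin n → padicCoeffIntegers S) → (Fin n → PadicAlgCl p) := fun v i ↦ (v i : PadicAlgCl p)
  have hι : ∀ (σ : absoluteGaloisGroup ℚ) (v : Fin n → padicCoeffIntegers S),
      ρK σ (ι v) = ι (ρ.toGaloisRep σ v) := by
    intro σ v
    rw [FramedRep.baseChangeRepresentation_apply_apply, FramedRep.toContinuousRep_apply_apply]
    funext i
    change (((ρ σ : GL (Fin n) (padicCoeffIntegers S)) : Matrix _ _ _).map φ *ᵥ (φ ∘ v)) i = φ (_)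
    rw [RingHom.map_mulVec]
  have hιinj : Function.Injective ι := fun v w h ↦ funext fun i ↦ Subtype.ext (congr_fun h i)
  -- the `G`-fixed vectors and their `K`-span, a subrepresentation
  let F : Set (Fin n → padicCoeffIntegers S) := {v | ∀ g ∈ G, ρ.toGaloisRep g v = v}
  have hFstable : ∀ (σ : absoluteGaloisGroup ℚ), ∀ v ∈ F, ρ.toGaloisRep σ v ∈ F := by
    intro σ v hv g hg
    have hg' : σ⁻¹ * g * σ ∈ G := by
      have := ‹G.Normal›.conj_mem g hg σ⁻¹; rwa [inv_inv] at this
    have h := hv _ hg'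
    rw [map_mul, map_mul, Module.End.mul_apply, Module.End.mul_apply] at h
    have h' := congrArg (ρ.toGaloisRep σ) h
    rw [← Module.End.mul_apply, ← map_mul, mul_inv_cancel, map_one, Module.End.one_apply] at h'
    exact h'
  let V : Submodule (PadicAlgCl p) (Fin n → PadicAlgCl p) := Submodule.span (PadicAlgCl p) (ι '' F)
  have hVstable : ∀ (σ : absoluteGaloisGroup ℚ), ∀ v ∈ V, ρK σ v ∈ V := by
    intro σ v hv
    have hle : V.map (ρK σ) ≤ V := by
      rw [Submodule.map_span]
      refine Submodule.span_mono ?_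
      rintro _ ⟨_, ⟨w, hw, rfl⟩, rfl⟩
      exact ⟨ρ.toGaloisRep σ w, hFstable σ w hw, (hι σ w).symm⟩
    exact hle (Submodule.mem_map_of_mem hv)
  let Vsub : Subrepresentation ρK := ⟨V, fun σ v hv ↦ hVstable σ v hv⟩
  have hmV : ι m ∈ V := Submodule.subset_span ⟨m, hm, rfl⟩
  haveI := hirr
  rcases eq_bot_or_eq_top Vsub with hbot | htop
  · -- no non-zero fixed vector at all
    have hV : V = ⊥ := congrArg Subrepresentation.toSubmodule hbot
    rw [hV, Submodule.mem_bot] at hmV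
    exact hιinj (by rw [hmV]; rfl)
  · -- the fixed vectors span `Kⁿ`: `G` acts trivially, so the image of `ρ` is abelian
    exfalso
    have hV : V = ⊤ := congrArg Subrepresentation.toSubmodule htop
    have htriv : ∀ g ∈ G, ∀ v : Fin n → PadicAlgCl p, ρK g v = v := by
      intro g hg v
      have hv : v ∈ V := by rw [hV]; exact Submodule.mem_top
      refine Submodule.span_induction (p := fun v _ ↦ ρK g v = v) ?_ ?_ ?_ ?_ hv
      · rintro _ ⟨w, hw, rfl⟩
        rw [hι, hw g hg]
      · rw [map_zero]
      · intro x y _ _ hx hy; rw [map_add, hx, hy]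
      · intro a x _ hx; rw [map_smul, hx]
    have hone : ∀ g ∈ G, ρ g = 1 := by
      intro g hg
      apply Units.ext
      ext i j
      have h := congr_fun (htriv g hg (Pi.single j 1)) i
      rw [FramedRep.baseChangeRepresentation_apply_apply] at h
      change ((((ρ g : GL (Fin n) (padicCoeffIntegers S)) : Matrix _ _ _).map φ) *ᵥ Pi.single j 1) i
        = _ at h
      rw [Matrix.mulVec_single_one, Matrix.col_apply, Matrix.map_apply, Pi.single_apply] at h
      change φ (((ρ g : GL (Fin n) (padicCoeffIntegers S)) : Matrix _ _ _) i j) =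
        φ (((1 : GL (Fin n) (padicCoeffIntegers S)) : Matrix _ _ _) i j)
      rw [h, Units.val_one, Matrix.one_apply]
      split_ifs <;> simp
    obtain ⟨σ, τ, hστ⟩ := hnonab
    apply hστ
    have h := hone _ (hG σ τ)
    rw [map_mul, map_mul, map_mul, map_inv, map_inv, mul_inv_eq_one, mul_inv_eq_iff_eq_mul] at h
    exact h

end IwasawaH1CoeffTorsionFree

namespace IwasawaH1DataCoeff

open IwasawaH1CoeffTorsionFree

variable {p : ℕ} [Fact p.Prime] {S : Set (PadicAlgCl p)} [FiniteDimensional ℚ_[p] (padicCoeffField S)]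
  {n : ℕ} {ρ : FramedGaloisRep ℚ (padicCoeffIntegers S) n} {κ : ZpExtension ℚ p} {γ : absoluteGaloisGroup ℚ}

omit [FiniteDimensional ℚ_[p] (padicCoeffField S)] in
/-- Commutators lie in the kernel of a `ℤ_p`-extension character (`ℤ_p` is commutative). [folklore] -/
private theorem commutator_mem_kerSubgroup (σ τ : absoluteGaloisGroup ℚ) :
    σ * τ * σ⁻¹ * τ⁻¹ ∈ κ.kerSubgroup := by
  rw [ZpExtension.mem_kerSubgroup, map_mul, map_mul, map_mul, map_inv, map_inv, mul_comm (κ σ) (κ τ),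
    mul_inv_cancel_right, mul_inv_cancel]

/-- **Kato Thm. 12.4 (2) for IRREDUCIBLE `𝒪_λ`-lattices: `𝐇¹_Γ(T_ρ)` is a TORSION-FREE
`Λ_𝒪`-module.**  For `𝒪 = padicCoeffIntegers S` (`ℚ_p(S)/ℚ_p` finite), `ρ : Γ_ℚ → GL_n(𝒪)` whose base
change to `ℚ̄_p` is irreducible with non-commutative image, every prime `p`, every `ℤ_p`-extension `κ`
of `ℚ` with topological generator `γ` and every pin `I : IwasawaH1DataCoeff ρ.toGaloisRep p κ γ`:
`Module.IsTorsionFree Λ_𝒪 I.H` (`forall_fixed_eq_zero_of_isIrreducible` for `G = ker κ`, then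
`isTorsionFree_of_forall_fixed_eq_zero`).
[cite: Kato2004Asterisque, Thm. 12.4 (2) (p. 221) and (14.10.5) (p. 241)] [cite: Ribet1977Nebentypus, Thm. 2.3] -/
theorem isTorsionFree_of_isIrreducible (I : IwasawaH1DataCoeff ρ.toGaloisRep p κ γ)
    (hγ : κ.IsTopGenerator γ)
    (hirr : (FramedRep.baseChangeRepresentation (padicCoeffIntegers S).subtype ρ).IsIrreducible)
    (hnonab : ∃ σ τ : absoluteGaloisGroup ℚ, ρ σ * ρ τ ≠ ρ τ * ρ σ) :
    Module.IsTorsionFree (IwasawaAlgebraO S) I.H := by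
  haveI : κ.kerSubgroup.Normal := by
    unfold ZpExtension.kerSubgroup; infer_instance
  exact I.isTorsionFree_of_forall_fixed_eq_zero hγ fun m hm ↦
    forall_fixed_eq_zero_of_isIrreducible S ρ κ.kerSubgroup commutator_mem_kerSubgroup hirr hnonab m hm

/-- **K0b clause (b) on its own binders, modulo IRREDUCIBILITY.**  For every prime `p`,
`g ∈ S₂(Γ₀(M))` with `IsNewform0 g`, `ι : K_g → ℚ̄_p`, lattice `ρ : Γ_ℚ → GL₂(𝒪)`
(`𝒪 = padicCoeffIntegers (Set.range ι)`), cyclotomic `κ` with topological generator `γ`, datum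
`I : IwasawaH1DataCoeff ρ.toGaloisRep p κ γ`: if `ρ ⊗ ℚ̄_p` is irreducible with non-abelian image
(Ribet, for the model of `V_{F_λ}(g)(1)`), then `Module.IsTorsionFree Λ_𝒪 I.H` — the middle conjunct of
`thm12_4_newform`. [cite: Kato2004Asterisque, Thm. 12.4 (2) (p. 221)] [cite: Ribet1977Nebentypus, Thm. 2.3] -/
theorem isTorsionFree_newform_of_isIrreducible {p : ℕ} [Fact p.Prime] {M : ℕ} [NeZero M]
    {g : CuspForm (CongruenceSubgroup.Gamma0 M) 2} (ι : ModularForms.coeffField g →+* PadicAlgCl p)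
    {ρ : FramedGaloisRep ℚ (padicCoeffIntegers (Set.range ι)) 2}
    {κ : ZpExtension ℚ p} {γ : absoluteGaloisGroup ℚ} (hg : ModularForms.IsNewform0 g)
    (hγ : κ.IsTopGenerator γ) (I : IwasawaH1DataCoeff ρ.toGaloisRep p κ γ)
    (hirr : (FramedRep.baseChangeRepresentation (padicCoeffIntegers (Set.range ι)).subtype ρ).IsIrreducible)
    (hnonab : ∃ σ τ : absoluteGaloisGroup ℚ, ρ σ * ρ τ ≠ ρ τ * ρ σ) :
    Module.IsTorsionFree (IwasawaAlgebraO (Set.range ι)) I.H := by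
  haveI : FiniteDimensional ℚ (ModularForms.coeffField g) :=
    ModularForms.IsNewform0.finiteDimensional_coeffField_holds hg
  haveI : FiniteDimensional ℚ_[p] (padicCoeffField (Set.range ι)) :=
    GreenbergSelmer.finiteDimensional_padicCoeffField ι
  exact I.isTorsionFree_of_isIrreducible hγ hirr hnonab

end IwasawaH1DataCoeff

end Literature.NumberTheory.EllipticCurves.Kato2004

end
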